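/-
Copyright: the b2b-balaban T⁴-continuum CRUX team, row NE7b OWNER lineage `t4-ne7b-p1` (gen 130). Project licence.
-/
import Summits.QuantumFields.BalabanUV.T4Continuum.Spine.NE7b.SupExpFamilyDerivative
import Mathlib.Analysis.SpecialFunctions.Log.Deriv

/-!
# THE TWO-PARAMETER EXPONENTIAL FAMILY THROUGH A WEIGHT: for measurable `Φ₀, A, B` on `(Ω, μ)` with ONE letter `∫|Φ₀|e^{4(|A|+|B|)}dμ < ∞`
# and `H(s,t) = ∫Φ₀e^{sA+tB}dμ > 0`, on the square `|s|, |t| ≤ 1` the free energy `f = log H` has the derivatives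
#   `∂_sf = ⟨A⟩`, `∂_s²f = ⟨A²⟩ − ⟨A⟩²`, `∂_t∂_sf = ⟨AB⟩ − ⟨A⟩⟨B⟩`, `∂_t²∂_sf = ⟨AB²⟩ − ⟨A⟩⟨B²⟩ − 2(⟨AB⟩ − ⟨A⟩⟨B⟩)⟨B⟩`
# (`⟨X⟩ = ∫Φ₀Xe^{sA+tB}∕H` the tilted means) in the `HasDerivAt` currency that (327) consumes — six applications of (328)'s
# differentiation of a tilt plus the quotient rule (row NE7b, node U5c; (328) BY NAME + Mathlib's `HasDerivAt.log`∕`.div`; [folklore])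

Cell `pub-balaban`, sub-cell `t4`, spine estimate NE7b (`T4WeightBudget.RelWeightBound`; the cell's OWN estimate — NOT PRINTED in
[Bałaban 1983–89], NOT PROVED).  Crux-route work under `Spine/NE7b/` by the row OWNER (`t4-ne7b-p1` gen 130, file (330)) under FREEZE
(0)'s crux-prover clause, on § [NE7bP1-G129-HANDOFF] NEXT (i)∕(ii) (SCOPING-d4: the cumulant structure of `log Z(s,t)`,
`Z(s,t) = ∫e^{−V}e^{sF_y+tG_z}dN(0,Γ)`, abstractly — `Φ₀ = e^{−V}`, `A = F_y`, `B = G_z`); NOTHING of Bałaban's is named as a Lean object,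
valued or asserted; no `T4Continuum/Support` leaf typed; no `def`, no notation; zero `sorry`.  Imports (BY NAME): the OWNER's (328)
`…SupExpFamilyDerivative` (`hasDerivAt_integral_mul_exp`, `abs_le_exp_abs`, `exp_mul_le_exp_abs`, `integrable_mul_exp_mul`); Mathlib's
`HasDerivAt.log`, `HasDerivAt.div`, `HasDerivAt.mul`, `integral_congr_ae`.

WHY (located).  (326) ⊕ (327): the tilted covariance `∂_t∂_s log Z(0,0)` is small once `∂_s²log Z` and `∂_t²∂_s log Z` are bounded on the
unit square; both are tilted cumulants.  This file produces them in closed form for an abstract weight, so that the road only has to supply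
its one Gaussian-regulated letter and its single-site moment bounds ((323)-style) — no further dominated differentiation downstream.

WHAT IS PROVED ([folklore]; `Φ₀, A, B : Ω → ℝ` measurable, the letter `∫|Φ₀|e^{4(|A|+|B|)}dμ < ∞`; all integrals in the canonical form
`I[X](s,t) = ∫Φ₀·X·e^{sA+tB}dμ`, `X ∈ {1, A, A², B, AB, B², AB²}`; `|s|, |t| ≤ 1`):
* §1 `hasDerivAt_tilt_s`, `hasDerivAt_tilt_t` (for a measurable weight `Ψ` with `∫|Ψ|e^{3(|A|+|B|)} < ∞`: `∂_sI_Ψ = I_{ΨA}`, `∂_tI_Ψ = I_{ΨB}`),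
  `weight_letter` (`|X| ≤ e^{|A|+|B|}` for `X ∈ {1, A, B, AB}` ⟹ the weights `Φ₀X` inherit the `3`-letter from the `4`-letter);
* §2 THE SIX DERIVATIVES `hasDerivAt_H_s`, `hasDerivAt_HA_s`, `hasDerivAt_H_t`, `hasDerivAt_HA_t`, `hasDerivAt_HB_t`, `hasDerivAt_HAB_t`;
* §3 THE END, the free energy `f = log H` (`H > 0` on the square): **`hasDerivAt_logH_s`** (`∂_sf = I[A]∕I[1]`), **`hasDerivAt_fs_s`**
  (`∂_s(I[A]∕I[1]) = (I[A²]I[1] − I[A]²)∕I[1]²`), **`hasDerivAt_fs_t`** (`∂_t(I[A]∕I[1]) = (I[AB]I[1] − I[A]I[B])∕I[1]²`), **`hasDerivAt_fst_t`**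
  (`∂_t` of the latter, quotient rule in raw form); §4 toy.

HONEST (what this is NOT).  Closed forms only; the BOUNDS of these cumulants by tilted absolute moments and the road's instantiation with
(326)∕(327) are the next file of SCOPING-d4; nothing of Bałaban's asserted.  BY-NAME EFFECT ON THE WALL: NONE.  NE7b NOT PRINTED ∕ NOT PROVED;
spine PROVED 0∕9; rung (B)+1 — the programme's measures remain FINITE-torus statements; NOT the mass gap, NOT Clay.  HONEST DEPENDENCY:
continuum YM on T⁴ ⇐ BetaPertH ∧ nine spine estimates (0∕9 proved); BetaPertH ⇐ (D1) ∧ (D4) ∧ CAP+tail; G-an2-4 gates asym, D1 and NE2∕3∕4.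
-/

set_option autoImplicit false

noncomputable section

namespace Summit.QuantumFields.BalabanUV.T4Continuum.NE7b.SupExpFamilyLogDerivatives

open MeasureTheory Real Set
open SupExpFamilyDerivative (hasDerivAt_integral_mul_exp abs_le_exp_abs exp_mul_le_exp_abs integrable_mul_exp_mul)

variable {Ω : Type*} [MeasurableSpace Ω] {μ : Measure Ω} {Φ₀ A B : Ω → ℝ}

/-! ## §1. One tilt at a time -/

/-- **`∂_s` of a tilt with a second, frozen tilt**: `Ψ, A, B` measurable, `∫|Ψ|e^{3(|A|+|B|)}dμ < ∞`, `|s|, |t| ≤ 1` ⟹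
`HasDerivAt (s ↦ ∫Ψe^{sA+tB}dμ) (∫ΨAe^{sA+tB}dμ) s`. [folklore] -/
theorem hasDerivAt_tilt_s {Ψ : Ω → ℝ} (hΨ : Measurable Ψ) (hA : Measurable A) (hB : Measurable B)
    (hdom : Integrable (fun ω => |Ψ ω| * exp (3 * (|A ω| + |B ω|))) μ) {s t : ℝ} (hs : |s| ≤ 1) (ht : |t| ≤ 1) :
    HasDerivAt (fun s => ∫ ω, Ψ ω * exp (s * A ω + t * B ω) ∂μ) (∫ ω, Ψ ω * A ω * exp (s * A ω + t * B ω) ∂μ) s := by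
  -- the frozen tilt joins the weight: `Φ = Ψe^{tB}` has the `3`-letter in `A`
  have hΦm : Measurable fun ω => Ψ ω * exp (t * B ω) := hΨ.mul (measurable_exp.comp (hB.const_mul t))
  have hΦdom : Integrable (fun ω => |Ψ ω * exp (t * B ω)| * exp (3 * |A ω|)) μ := by
    refine hdom.mono' ((continuous_abs.measurable.comp hΦm).mul
      (measurable_exp.comp ((continuous_abs.measurable.comp hA).const_mul 3))).aestronglyMeasurable (ae_of_all _ fun ω => ?_)
    rw [Real.norm_of_nonneg (mul_nonneg (abs_nonneg _) (exp_pos _).le), abs_mul, abs_of_pos (exp_pos _), mul_assoc, ← exp_add]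
    refine mul_le_mul_of_nonneg_left (exp_le_exp.2 ?_) (abs_nonneg _)
    have h1 : t * B ω ≤ 1 * |B ω| := by
      calc t * B ω ≤ |t * B ω| := le_abs_self _
        _ = |t| * |B ω| := abs_mul _ _
        _ ≤ 1 * |B ω| := mul_le_mul_of_nonneg_right ht (abs_nonneg _)
    nlinarith [abs_nonneg (B ω), abs_nonneg (A ω)]
  have h := hasDerivAt_integral_mul_exp (μ := μ) hΦm hA hΦdom (s₀ := s) (by linarith)
  have e1 : (fun s => ∫ ω, Ψ ω * exp (s * A ω + t * B ω) ∂μ) = fun s => ∫ ω, Ψ ω * exp (t * B ω) * exp (s * A ω) ∂μ :=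
    funext fun s => integral_congr_ae (ae_of_all _ fun ω => by simp only [exp_add]; ring)
  have e2 : ∫ ω, Ψ ω * A ω * exp (s * A ω + t * B ω) ∂μ = ∫ ω, Ψ ω * exp (t * B ω) * A ω * exp (s * A ω) ∂μ :=
    integral_congr_ae (ae_of_all _ fun ω => by simp only [exp_add]; ring)
  rw [e1, e2]
  exact h

/-- **`∂_t` of a tilt with the `s`-tilt frozen**: symmetric to `hasDerivAt_tilt_s`. [folklore] -/
theorem hasDerivAt_tilt_t {Ψ : Ω → ℝ} (hΨ : Measurable Ψ) (hA : Measurable A) (hB : Measurable B)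
    (hdom : Integrable (fun ω => |Ψ ω| * exp (3 * (|A ω| + |B ω|))) μ) {s t : ℝ} (hs : |s| ≤ 1) (ht : |t| ≤ 1) :
    HasDerivAt (fun t => ∫ ω, Ψ ω * exp (s * A ω + t * B ω) ∂μ) (∫ ω, Ψ ω * B ω * exp (s * A ω + t * B ω) ∂μ) t := by
  have hdom' : Integrable (fun ω => |Ψ ω| * exp (3 * (|B ω| + |A ω|))) μ :=
    hdom.congr (ae_of_all _ fun ω => by dsimp only; rw [add_comm (|A ω|)])
  have h := hasDerivAt_tilt_s (μ := μ) hΨ hB hA hdom' ht hs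
  have e1 : (fun t => ∫ ω, Ψ ω * exp (s * A ω + t * B ω) ∂μ) = fun t => ∫ ω, Ψ ω * exp (t * B ω + s * A ω) ∂μ :=
    funext fun t => integral_congr_ae (ae_of_all _ fun ω => by dsimp only; rw [add_comm])
  have e2 : ∫ ω, Ψ ω * B ω * exp (s * A ω + t * B ω) ∂μ = ∫ ω, Ψ ω * B ω * exp (t * B ω + s * A ω) ∂μ :=
    integral_congr_ae (ae_of_all _ fun ω => by dsimp only; rw [add_comm])
  rw [e1, e2]
  exact h

/-- **The weights `Φ₀X`, `|X| ≤ e^{|A|+|B|}`, inherit the `3`-letter from the `4`-letter of `Φ₀`.** [folklore] -/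
theorem weight_letter (hΦ₀ : Measurable Φ₀) (hA : Measurable A) (hB : Measurable B)
    (hdom : Integrable (fun ω => |Φ₀ ω| * exp (4 * (|A ω| + |B ω|))) μ) {X : Ω → ℝ} (hX : Measurable X)
    (hXle : ∀ ω, |X ω| ≤ exp (|A ω| + |B ω|)) :
    Integrable (fun ω => |Φ₀ ω * X ω| * exp (3 * (|A ω| + |B ω|))) μ := by
  refine hdom.mono' ((continuous_abs.measurable.comp (hΦ₀.mul hX)).mul (measurable_exp.comp
    (((continuous_abs.measurable.comp hA).add (continuous_abs.measurable.comp hB)).const_mul 3))).aestronglyMeasurable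
    (ae_of_all _ fun ω => ?_)
  rw [Real.norm_of_nonneg (mul_nonneg (abs_nonneg _) (exp_pos _).le), abs_mul, mul_assoc]
  refine mul_le_mul_of_nonneg_left ?_ (abs_nonneg _)
  calc |X ω| * exp (3 * (|A ω| + |B ω|)) ≤ exp (|A ω| + |B ω|) * exp (3 * (|A ω| + |B ω|)) :=
        mul_le_mul_of_nonneg_right (hXle ω) (exp_pos _).le
    _ = exp (4 * (|A ω| + |B ω|)) := by rw [← exp_add]; congr 1; ring

omit [MeasurableSpace Ω] in
/-- `|1| ≤ e^{|A|+|B|}`, `|A| ≤ e^{|A|+|B|}`, `|B| ≤ e^{|A|+|B|}`, `|AB| ≤ e^{|A|+|B|}`. [folklore] -/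
theorem monomial_letters (ω : Ω) : |(1 : ℝ)| ≤ exp (|A ω| + |B ω|) ∧ |A ω| ≤ exp (|A ω| + |B ω|) ∧ |B ω| ≤ exp (|A ω| + |B ω|) ∧
    |A ω * B ω| ≤ exp (|A ω| + |B ω|) := by
  have hA := abs_le_exp_abs (A ω)
  have hB := abs_le_exp_abs (B ω)
  have h1A : 1 ≤ exp |A ω| := one_le_exp (abs_nonneg _)
  have h1B : 1 ≤ exp |B ω| := one_le_exp (abs_nonneg _)
  rw [exp_add, abs_one, abs_mul]
  refine ⟨?_, ?_, ?_, ?_⟩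
  · nlinarith
  · nlinarith [abs_nonneg (A ω)]
  · nlinarith [abs_nonneg (B ω)]
  · exact mul_le_mul hA hB (abs_nonneg _) (exp_pos _).le

/-! ## §2. The six derivatives of the family's integrals -/

section Six

variable (hΦ₀ : Measurable Φ₀) (hA : Measurable A) (hB : Measurable B)
  (hdom : Integrable (fun ω => |Φ₀ ω| * exp (4 * (|A ω| + |B ω|))) μ)
include hΦ₀ hA hB hdom

/-- `∂_s I[1] = I[A]`. [folklore] -/
theorem hasDerivAt_H_s {s t : ℝ} (hs : |s| ≤ 1) (ht : |t| ≤ 1) :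
    HasDerivAt (fun s => ∫ ω, Φ₀ ω * exp (s * A ω + t * B ω) ∂μ) (∫ ω, Φ₀ ω * A ω * exp (s * A ω + t * B ω) ∂μ) s := by
  have hw := weight_letter (μ := μ) hΦ₀ hA hB hdom measurable_const fun ω => (monomial_letters (A := A) (B := B) ω).1
  simp only [mul_one] at hw
  exact hasDerivAt_tilt_s hΦ₀ hA hB hw hs ht

/-- `∂_s I[A] = I[A²]`. [folklore] -/
theorem hasDerivAt_HA_s {s t : ℝ} (hs : |s| ≤ 1) (ht : |t| ≤ 1) :
    HasDerivAt (fun s => ∫ ω, Φ₀ ω * A ω * exp (s * A ω + t * B ω) ∂μ) (∫ ω, Φ₀ ω * A ω * A ω * exp (s * A ω + t * B ω) ∂μ) s :=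
  hasDerivAt_tilt_s (hΦ₀.mul hA) hA hB (weight_letter hΦ₀ hA hB hdom hA fun ω => (monomial_letters (A := A) (B := B) ω).2.1) hs ht

/-- `∂_t I[1] = I[B]`. [folklore] -/
theorem hasDerivAt_H_t {s t : ℝ} (hs : |s| ≤ 1) (ht : |t| ≤ 1) :
    HasDerivAt (fun t => ∫ ω, Φ₀ ω * exp (s * A ω + t * B ω) ∂μ) (∫ ω, Φ₀ ω * B ω * exp (s * A ω + t * B ω) ∂μ) t := by
  have hw := weight_letter (μ := μ) hΦ₀ hA hB hdom measurable_const fun ω => (monomial_letters (A := A) (B := B) ω).1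
  simp only [mul_one] at hw
  exact hasDerivAt_tilt_t hΦ₀ hA hB hw hs ht

/-- `∂_t I[A] = I[AB]`. [folklore] -/
theorem hasDerivAt_HA_t {s t : ℝ} (hs : |s| ≤ 1) (ht : |t| ≤ 1) :
    HasDerivAt (fun t => ∫ ω, Φ₀ ω * A ω * exp (s * A ω + t * B ω) ∂μ) (∫ ω, Φ₀ ω * A ω * B ω * exp (s * A ω + t * B ω) ∂μ) t :=
  hasDerivAt_tilt_t (hΦ₀.mul hA) hA hB (weight_letter hΦ₀ hA hB hdom hA fun ω => (monomial_letters (A := A) (B := B) ω).2.1) hs ht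

/-- `∂_t I[B] = I[B²]`. [folklore] -/
theorem hasDerivAt_HB_t {s t : ℝ} (hs : |s| ≤ 1) (ht : |t| ≤ 1) :
    HasDerivAt (fun t => ∫ ω, Φ₀ ω * B ω * exp (s * A ω + t * B ω) ∂μ) (∫ ω, Φ₀ ω * B ω * B ω * exp (s * A ω + t * B ω) ∂μ) t :=
  hasDerivAt_tilt_t (hΦ₀.mul hB) hA hB (weight_letter hΦ₀ hA hB hdom hB fun ω => (monomial_letters (A := A) (B := B) ω).2.2.1) hs ht

/-- `∂_t I[AB] = I[AB²]`. [folklore] -/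
theorem hasDerivAt_HAB_t {s t : ℝ} (hs : |s| ≤ 1) (ht : |t| ≤ 1) :
    HasDerivAt (fun t => ∫ ω, Φ₀ ω * A ω * B ω * exp (s * A ω + t * B ω) ∂μ)
      (∫ ω, Φ₀ ω * A ω * B ω * B ω * exp (s * A ω + t * B ω) ∂μ) t := by
  have hw := weight_letter (μ := μ) hΦ₀ hA hB hdom (X := fun ω => A ω * B ω) (hA.mul hB)
    fun ω => (monomial_letters (A := A) (B := B) ω).2.2.2
  have h := hasDerivAt_tilt_t (μ := μ) (Ψ := fun ω => Φ₀ ω * (A ω * B ω)) (hΦ₀.mul (hA.mul hB)) hA hB hw hs ht (s := s) (t := t)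
  have e1 : (fun t => ∫ ω, Φ₀ ω * A ω * B ω * exp (s * A ω + t * B ω) ∂μ) =
      fun t => ∫ ω, Φ₀ ω * (A ω * B ω) * exp (s * A ω + t * B ω) ∂μ :=
    funext fun t => integral_congr_ae (ae_of_all _ fun ω => by dsimp only; rw [mul_assoc (Φ₀ ω)])
  have e2 : ∫ ω, Φ₀ ω * A ω * B ω * B ω * exp (s * A ω + t * B ω) ∂μ = ∫ ω, Φ₀ ω * (A ω * B ω) * B ω * exp (s * A ω + t * B ω) ∂μ :=
    integral_congr_ae (ae_of_all _ fun ω => by dsimp only; rw [mul_assoc (Φ₀ ω) (A ω)])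
  rw [e1, e2]
  exact h

/-! ## §3. THE END: the free energy's derivatives in closed form -/

/-- **`∂_s log H = I[A]∕I[1]`** (`H = I[1] > 0` on the square). [folklore] -/
theorem hasDerivAt_logH_s (hpos : ∀ s t : ℝ, |s| ≤ 1 → |t| ≤ 1 → 0 < ∫ ω, Φ₀ ω * exp (s * A ω + t * B ω) ∂μ) {s t : ℝ}
    (hs : |s| ≤ 1) (ht : |t| ≤ 1) :
    HasDerivAt (fun s => log (∫ ω, Φ₀ ω * exp (s * A ω + t * B ω) ∂μ))
      ((∫ ω, Φ₀ ω * A ω * exp (s * A ω + t * B ω) ∂μ) / (∫ ω, Φ₀ ω * exp (s * A ω + t * B ω) ∂μ)) s :=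
  (hasDerivAt_H_s hΦ₀ hA hB hdom hs ht).log (hpos s t hs ht).ne'

/-- **`∂_s(I[A]∕I[1]) = (I[A²]·I[1] − I[A]·I[A])∕I[1]²`** — the tilted VARIANCE of `A`. [folklore] -/
theorem hasDerivAt_fs_s (hpos : ∀ s t : ℝ, |s| ≤ 1 → |t| ≤ 1 → 0 < ∫ ω, Φ₀ ω * exp (s * A ω + t * B ω) ∂μ) {s t : ℝ}
    (hs : |s| ≤ 1) (ht : |t| ≤ 1) :
    HasDerivAt (fun s => (∫ ω, Φ₀ ω * A ω * exp (s * A ω + t * B ω) ∂μ) / (∫ ω, Φ₀ ω * exp (s * A ω + t * B ω) ∂μ))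
      (((∫ ω, Φ₀ ω * A ω * A ω * exp (s * A ω + t * B ω) ∂μ) * (∫ ω, Φ₀ ω * exp (s * A ω + t * B ω) ∂μ) -
        (∫ ω, Φ₀ ω * A ω * exp (s * A ω + t * B ω) ∂μ) * (∫ ω, Φ₀ ω * A ω * exp (s * A ω + t * B ω) ∂μ)) /
        (∫ ω, Φ₀ ω * exp (s * A ω + t * B ω) ∂μ) ^ 2) s :=
  (hasDerivAt_HA_s hΦ₀ hA hB hdom hs ht).div (hasDerivAt_H_s hΦ₀ hA hB hdom hs ht) (hpos s t hs ht).ne'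

/-- **`∂_t(I[A]∕I[1]) = (I[AB]·I[1] − I[A]·I[B])∕I[1]²`** — the tilted COVARIANCE of `A` and `B`. [folklore] -/
theorem hasDerivAt_fs_t (hpos : ∀ s t : ℝ, |s| ≤ 1 → |t| ≤ 1 → 0 < ∫ ω, Φ₀ ω * exp (s * A ω + t * B ω) ∂μ) {s t : ℝ}
    (hs : |s| ≤ 1) (ht : |t| ≤ 1) :
    HasDerivAt (fun t => (∫ ω, Φ₀ ω * A ω * exp (s * A ω + t * B ω) ∂μ) / (∫ ω, Φ₀ ω * exp (s * A ω + t * B ω) ∂μ))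
      (((∫ ω, Φ₀ ω * A ω * B ω * exp (s * A ω + t * B ω) ∂μ) * (∫ ω, Φ₀ ω * exp (s * A ω + t * B ω) ∂μ) -
        (∫ ω, Φ₀ ω * A ω * exp (s * A ω + t * B ω) ∂μ) * (∫ ω, Φ₀ ω * B ω * exp (s * A ω + t * B ω) ∂μ)) /
        (∫ ω, Φ₀ ω * exp (s * A ω + t * B ω) ∂μ) ^ 2) t :=
  (hasDerivAt_HA_t hΦ₀ hA hB hdom hs ht).div (hasDerivAt_H_t hΦ₀ hA hB hdom hs ht) (hpos s t hs ht).ne'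

/-- **THE END — `∂_t` OF THE TILTED COVARIANCE** (quotient rule in raw form, from `∂_tI[AB] = I[AB²]`, `∂_tI[1] = I[B]`, `∂_tI[A] = I[AB]`,
`∂_tI[B] = I[B²]`): the third cumulant `∂_t²∂_s log H` that (327) bounds. [folklore] -/
theorem hasDerivAt_fst_t (hpos : ∀ s t : ℝ, |s| ≤ 1 → |t| ≤ 1 → 0 < ∫ ω, Φ₀ ω * exp (s * A ω + t * B ω) ∂μ) {s t : ℝ}
    (hs : |s| ≤ 1) (ht : |t| ≤ 1) :
    HasDerivAt (fun t => ((∫ ω, Φ₀ ω * A ω * B ω * exp (s * A ω + t * B ω) ∂μ) * (∫ ω, Φ₀ ω * exp (s * A ω + t * B ω) ∂μ) -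
        (∫ ω, Φ₀ ω * A ω * exp (s * A ω + t * B ω) ∂μ) * (∫ ω, Φ₀ ω * B ω * exp (s * A ω + t * B ω) ∂μ)) /
        (∫ ω, Φ₀ ω * exp (s * A ω + t * B ω) ∂μ) ^ 2)
      ((((∫ ω, Φ₀ ω * A ω * B ω * B ω * exp (s * A ω + t * B ω) ∂μ) * (∫ ω, Φ₀ ω * exp (s * A ω + t * B ω) ∂μ) +
          (∫ ω, Φ₀ ω * A ω * B ω * exp (s * A ω + t * B ω) ∂μ) * (∫ ω, Φ₀ ω * B ω * exp (s * A ω + t * B ω) ∂μ) -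
          ((∫ ω, Φ₀ ω * A ω * B ω * exp (s * A ω + t * B ω) ∂μ) * (∫ ω, Φ₀ ω * B ω * exp (s * A ω + t * B ω) ∂μ) +
            (∫ ω, Φ₀ ω * A ω * exp (s * A ω + t * B ω) ∂μ) * (∫ ω, Φ₀ ω * B ω * B ω * exp (s * A ω + t * B ω) ∂μ))) *
          (∫ ω, Φ₀ ω * exp (s * A ω + t * B ω) ∂μ) ^ 2 -
        ((∫ ω, Φ₀ ω * A ω * B ω * exp (s * A ω + t * B ω) ∂μ) * (∫ ω, Φ₀ ω * exp (s * A ω + t * B ω) ∂μ) -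
          (∫ ω, Φ₀ ω * A ω * exp (s * A ω + t * B ω) ∂μ) * (∫ ω, Φ₀ ω * B ω * exp (s * A ω + t * B ω) ∂μ)) *
          (2 * (∫ ω, Φ₀ ω * exp (s * A ω + t * B ω) ∂μ) * (∫ ω, Φ₀ ω * B ω * exp (s * A ω + t * B ω) ∂μ))) /
        ((∫ ω, Φ₀ ω * exp (s * A ω + t * B ω) ∂μ) ^ 2) ^ 2) t := by
  have h1 := hasDerivAt_HAB_t hΦ₀ hA hB hdom hs ht (s := s) (t := t)
  have h2 := hasDerivAt_H_t hΦ₀ hA hB hdom hs ht (s := s) (t := t)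
  have h3 := hasDerivAt_HA_t hΦ₀ hA hB hdom hs ht (s := s) (t := t)
  have h4 := hasDerivAt_HB_t hΦ₀ hA hB hdom hs ht (s := s) (t := t)
  have hnum := (h1.mul h2).sub (h3.mul h4)
  have hden : HasDerivAt (fun t => (∫ ω, Φ₀ ω * exp (s * A ω + t * B ω) ∂μ) ^ 2)
      (2 * (∫ ω, Φ₀ ω * exp (s * A ω + t * B ω) ∂μ) * (∫ ω, Φ₀ ω * B ω * exp (s * A ω + t * B ω) ∂μ)) t :=
    (h2.pow 2).congr_deriv (by norm_num)
  exact hnum.div hden (pow_ne_zero 2 (hpos s t hs ht).ne')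

end Six

/-! ## §4. Toy -/

/-- Toy (§1): `|1| ≤ e^{|a|+|b|}` for reals. -/
example (a b : ℝ) : |(1 : ℝ)| ≤ exp (|a| + |b|) := (monomial_letters (Ω := Unit) (A := fun _ => a) (B := fun _ => b) ()).1

end Summit.QuantumFields.BalabanUV.T4Continuum.NE7b.SupExpFamilyLogDerivatives
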